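import Summits.ResolutionOfSingularities.ResolutionOfSingularities.Theorems.HilbertSamuelEliminationSigmaMaxModificationsCorridor3Directrix214SharpNearFibre
import Literature.AlgebraicGeometry.CossartJannsenSaito2020.NearPointProjDirectrix
import HarnessLib

/-!
# [OURS · L1 W4.2] CJS Thm. 3.14 for POINT centres, LOCUS form, FROM [H4] THEOREM IV ALONE:
# `thm314_point_locus_of_thmIV : Hironaka1970_thmIV → Thm314_point_locus`

Cell res-hironaka, rung L, slot W4.2 (crux `SigmaMaxModifications`, stmt-ResolutionOfSingularities-18506; conjunct
`SigmaMaxModificationsCorridor3`, stmt-ResolutionOfSingularities-19249), helper class; res-L1-w42-plan-1 RULING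
v3.14-15 (DW) «`Thm314_point_locus` WIRING». [OURS · L1 W4.2] new-combination; NOT a statement of any source and NOT a
statement of H. Hironaka's 2017 manuscript.

WHAT. The print-faithful named fact `Literature.AlgebraicGeometry.CossartJannsenSaito2020.Thm314_point_locus` (CJS LNM
2270, Thm. 3.14 for the point centre `D = {x}`, LOCUS form: `X` excellent, `{x}` permissible, `π` the blow-up in `{x}`,
`x'` over `x` and near to `x`, `char k(x) = 0 ∨ dim X + 2 ≤ 2·char k(x)` ⇒ `x' ∈ ℙ(Dir_x(X))`, tree
`IsOnProjDirectrix π x'`; FACT-LIST F-59) FOLLOWS from Hironaka 1970, THEOREM IV for the point centre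
(`Hironaka1970_thmIV_point`, F-51) alone — hence from its general-centre form (`Hironaka1970_thmIV`, F-51′) — in EVERY
characteristic. No new printed input is needed: the locus form is carried by F-51 through the tree's chart dictionary
`projDirLiftsInto_iff_directrixSpace_le_chartPrime` (res-type-001, T7), the characteristic-`0` core
`HironakaScheme.directrixSpace_le_prime_of_charZero` (res-D-lib-1) and the positive-characteristic core
`directrixSpace_le_prime_of_facts` (T7; F-52 `Hironaka1970_thm1_cor_holds` and F-50b
`mizutani1973_vectorGroup_of_dim_le_of_hironaka` PROVED), assembled by res-L1-w42-stub-3 as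
`thm314_point_locus_geomDir_of_thmIV_point` for the (F1♯) binder `Moving.Thm314_point_locus_geomDir` (hypothesis
`GeomDirHypothesis X x`: «`char κ(x) = 0 ∨ ē_x(X) + 2 ≤ 2·char κ(x)`»). Since (F1) implies (F1♯)
(`ē_x(X) ≤ dim 𝒪_{X,x} ≤ dim X`, `Moving.geomDirHypothesis_of_charHypothesis`), the print-faithful binder is a
COROLLARY of the (F1♯) one:

* `thm314_point_locus_of_geomDir : Moving.Thm314_point_locus_geomDir → Thm314_point_locus`;
* `thm314_point_locus_of_thmIV_point : Hironaka1970_thmIV_point → Thm314_point_locus` (F-59 modulo F-51);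
* `thm314_point_locus_of_thmIV : Hironaka1970_thmIV → Thm314_point_locus` (F-59 modulo F-51′) — the (DW) wiring.

VALUE (plan-1 (DW)): every `(h314pt : Thm314_point_locus)` binder of the W-low rows (`…WLadderThirdDoorClosed`,
`…WLadderGradeOneUnits`, stub-4's `wlow3CharStrataM_of_thm_3_14_pointLocus_curve_centreIO`, the bundle
`Moving.LocalChainPrintedFacts`) reduces to FACT-LIST §A [H4] Th. IV; with res-D-lib-1's `cjs_thm_3_14_of_thmIV`
(numerical form) and stub-3's `thm314_nearFibre_subsingleton_of_facts` (near-fibre form, F-split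
`HerrmannIkedaOrbanz1988_cor_21_11_holds` PROVED) all three typed CJS-Thm-3.14 facts of the W4.2 files read MODULO
⟨`Hironaka1970_thmIV`⟩ only. AI-written (res-type-031 g10); AI review is weaker than expert review.
-/

set_option linter.dupNamespace false

noncomputable section

open CategoryTheory AlgebraicGeometry TopologicalSpace IsLocalRing
open Literature.AlgebraicGeometry.Resolution
open Literature.AlgebraicGeometry.CossartJannsenSaito2020
open Summit.ResolutionOfSingularities.ResolutionOfSingularities.Theorems.SigmaMaxModificationsCorridor3.Moving

namespace Summit.ResolutionOfSingularities.ResolutionOfSingularities.Theorems.SigmaMaxModificationsCorridor3.Directrix214Sharp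

universe u

/-- **(F1♯) binder ⇒ print-faithful (F1) binder**: the OURS carrier `Moving.Thm314_point_locus_geomDir` (hypothesis
«`char κ(x) = 0 ∨ ē_x(X) + 2 ≤ 2·char κ(x)`») implies CJS Thm. 3.14 for point centres in locus form as typed,
`Thm314_point_locus` (hypothesis `CharHypothesis X x`: «`char k(x) = 0 ∨ dim X + 2 ≤ 2·char k(x)`»), because
`ē_x(X) ≤ dim 𝒪_{X,x} ≤ dim X` (`Moving.geomDirHypothesis_of_charHypothesis`). [OURS · L1 W4.2] composition.
[cite: CossartJannsenSaito2020, Thm. 3.14, Def. 2.21] -/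
theorem thm314_point_locus_of_geomDir (h : Moving.Thm314_point_locus_geomDir.{u}) : Thm314_point_locus.{u} := by
  intro X X' _ π x hx N x' hexc hperm hπ hdim hxx' hCH hnear
  exact h X X' π x hx N x' hexc hperm hπ hdim hxx' (geomDirHypothesis_of_charHypothesis hCH) hnear

/-- **CJS Thm. 3.14 for POINT centres, locus form (`Thm314_point_locus`, F-59), from [H4] THEOREM IV for the point
centre (`Hironaka1970_thmIV_point`, F-51) ALONE, in every characteristic**: stub-3's
`thm314_point_locus_geomDir_of_thmIV_point` (chart dictionary + `directrixSpace_le_prime_of_charZero` /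
`directrixSpace_le_prime_of_facts` with F-52/F-50b proved) followed by `thm314_point_locus_of_geomDir`.
[OURS · L1 W4.2] new-combination. [cite: Hironaka1970NumericalCharacters, Th. IV p. 156, (14.3) p. 170;
CossartJannsenSaito2020, Thm. 3.14 and its proof p. 51–52] -/
theorem thm314_point_locus_of_thmIV_point (h : Hironaka1970_thmIV_point.{u}) : Thm314_point_locus.{u} :=
  thm314_point_locus_of_geomDir (thm314_point_locus_geomDir_of_thmIV_point h)

/-- **CJS Thm. 3.14 for POINT centres, locus form (`Thm314_point_locus`, F-59), from [H4] THEOREM IV for an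
arbitrary permissible centre (`Hironaka1970_thmIV`, F-51′) ALONE** — res-L1-w42-plan-1 RULING v3.14-15 (DW): the
general-centre fact specialises to the point-centre one (`Hironaka1970_thmIV_point_of_thmIV`), then
`thm314_point_locus_of_thmIV_point`. [OURS · L1 W4.2] new-combination.
[cite: Hironaka1970NumericalCharacters, Th. IV p. 156; CossartJannsenSaito2020, Thm. 3.14] -/
theorem thm314_point_locus_of_thmIV (h : Hironaka1970_thmIV.{u}) : Thm314_point_locus.{u} :=
  thm314_point_locus_of_thmIV_point (Hironaka1970_thmIV_point_of_thmIV h)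

end Summit.ResolutionOfSingularities.ResolutionOfSingularities.Theorems.SigmaMaxModificationsCorridor3.Directrix214Sharp

end
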